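import Literature.Computability.AlgebraicComplexity.KV20UniversalCircuit
import Literature.Computability.AlgebraicComplexity.KV20UniversalMapInt
import Literature.Barriers.ValiantsHypothesis.BILPS19Cor42Machine
import HarnessLib

/-!
# Kumar–Volk 2020/2022, Cor 1.3 (reduction roster, brick (W), part b): the code word of
# `C ∘ Ũ_n` is written in polynomial time

Source: M. Kumar, B. L. Volk, ACM TOCT 14(2) (2022) art. 6 = arXiv:2003.12938, §6 = arXiv §5
(proof of Cor 1.3, p0009:L8–13): the `NP` verifier, given `1^n` and a guessed constant-free
circuit `C`, "uses polynomial identity testing to check" `C ∘ U ≡ 0`; for that the code of the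
division-free integer circuit `C ∘ Ũ_n` must be WRITTEN from `(1^n, 1^s, code of C)` by a
polynomial-time string function. Cell val-lit, roster RULING (105)/(106), brick (W) part b (the
STRING half of `KV20UniversalCircuit.lean`), on the template of `BILPS19Cor42Machine.lean` (x5):

* §1 the `ℕ`-indexed twins `linGateN`, `termGateN`, `chartN`, `univBodyN` of the gate lists of
  `KumarVolk2020.UnivCircuit` and **`forgetFin_univCircuit`** — the circuit code forgets the variable
  bound (`BILPS2019Cor42.circuitWord_eq_wordE`), so `wordE (s+s, univBodyN n s B) = circuitWord (s+s)
  (univCircuit n s B)`;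
* §2 every block on codes in the typed `CodeFP` algebra (one `CodeFP.map` over a unary range per
  block; indices by `natAdd`/`natMul`/`natDiv`/`natMod`; the use by `BILPS2019Cor42.useGatesRefFP`,
  the guessed gate list read by the tree's total reader `KIReduction.readBlock`);
* §3 **`univWordFP`**: on any context carrying `1^n`, `1^s` and a witness string (as `CodeFP` data),
  the map `c ↦ wordE (s+s, univBodyN n s (readBlock (wit c)))` is `CodeFP`, i.e. computed on codes by
  a polynomial-time string function; `wordE_univBodyN` identifies the word with the `PITLanguage`
  instance `circuitWord (s+s) (univCircuit n s (readBlock (wit c)))`.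

Theorem-only file with plumbing `def`s (the twins); 0 facts. HONEST FRAMING (val-lit): Boolean
plumbing of a published CONDITIONAL result; `VP ≠ VNP` is NOT proved and nothing here bears on it.

## References

* [KumarVolk2022] M. Kumar, B. L. Volk, ACM TOCT 14(2) (2022) art. 6 = arXiv:2003.12938, §6 /
  arXiv §5 p0009:L8–13 (the verifier writes and tests `C ∘ U`), §4.1 (the universal circuit).
* [KabanetsImpagliazzo2003] V. Kabanets, R. Impagliazzo, STOC 2003, proof of Cor. 12 (p. 358)
  (writing guessed gate lists).
* [AroraBarak2009] S. Arora, B. Barak, *Computational Complexity: A Modern Approach*, CUP 2009,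
  §0.1 (codes), §1.3 (polynomial time: composition, bounded loops).
-/

noncomputable section

namespace Literature.Computability.AlgebraicComplexity

namespace KumarVolk2020

namespace UnivCircuit

open Literature.Computability.Complexity ArithCircuit KIReduction
open Literature.Barriers.ValiantsHypothesis.BILPS2019Cor42
open _root_.Computability CodeFP Brick

/-! ### §1. The `ℕ`-indexed twins and the forgetful lemma -/

section Twins

variable (n s : ℕ)

/-- Twin of `linGate`. [cite: KumarVolk2022, Lemma 3.1 (proof)] -/
def linGateN (r : ℕ) : Gate ℤ ℕ :=
  .sum [(1, varOpN (s + s) (s + r / nSlot n s)), (-1, .const (r % nSlot n s : ℕ))]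

/-- Twin of `numGate` (no variables). [cite: KumarVolk2022, Lemma 3.1 (proof)] -/
def numGateN (r : ℕ) : Gate ℤ ℕ :=
  .prod (((List.range (nSlot n s)).filter fun a' => a' ≠ r % nSlot n s).map
    fun a' => .gate (linIdx n s (r / nSlot n s) a'))

/-- Twin of `termGate`. [cite: KumarVolk2022, Lemma 3.1 (proof)] -/
def termGateN (r : ℕ) : Gate ℤ ℕ :=
  .prod [.gate (numIdx n s (r / nSlot n s) (r % nSlot n s)), varOpN (s + s) (r / nSlot n s)]

/-- Twin of `svGate` (no variables). [cite: KumarVolk2022, Lemma 3.1 (proof)] -/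
def svGateN (a : ℕ) : Gate ℤ ℕ :=
  .sum ((List.range s).map fun j => ((1 : ℤ), .gate (termIdx n s j a)))

/-- Twin of `valGate` (no variables). [cite: KumarVolk2022, §4.1] -/
def valGateN (r : ℕ) : Gate ℤ ℕ :=
  if r % (s + 1) < s then
    if r % (s + 1) < r / (s + 1) / n then
      .prod [.gate (svIdx n s (ggCode n s (r / (s + 1) / n) (r % (s + 1)))),
        .gate (valIdx n s (r % (s + 1)) (r / (s + 1) % n))]
    else .sum []
  else .sum (((1 : ℤ), .gate (svIdx n s (inCode n (r / (s + 1) / n) (r / (s + 1) % n)))) ::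
    (List.range s).map fun t' => ((1 : ℤ), .gate (valBase n s + r / (s + 1) * (s + 1) + t')))

/-- Twin of `outGate` (no variables). [cite: KumarVolk2022, §4.1] -/
def outGateN (r : ℕ) : Gate ℤ ℕ :=
  if r % (s + 1) < s then
    .prod [.gate (svIdx n s (ogCode n s (r / (s + 1) / n) (r % (s + 1)))),
      .gate (valIdx n s (r % (s + 1)) (r / (s + 1) % n))]
  else .sum (((1 : ℤ), .gate (svIdx n s (oiCode n s (r / (s + 1) / n) (r / (s + 1) % n)))) ::
    (List.range s).map fun t => ((1 : ℤ), .gate (outBase n s + r / (s + 1) * (s + 1) + t)))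

/-- Twin of `chart`. [cite: KumarVolk2022, §4.1] -/
def chartN : List (Gate ℤ ℕ) :=
  (List.range (s * nSlot n s)).map (linGateN n s) ++ (List.range (s * nSlot n s)).map (numGateN n s) ++
    (List.range (s * nSlot n s)).map (termGateN n s) ++ (List.range (nSlot n s)).map (svGateN n s) ++
    (List.range (s * n * (s + 1))).map (valGateN n s) ++ (List.range (n * n * (s + 1))).map (outGateN n s)

/-- Twin of the body of `univCircuit`: gates and output. [cite: KumarVolk2022, §6 (proof of Cor. 1.3)] -/
def univBodyN (B : KBlock) : List (Gate ℤ ℕ) × Operand ℤ ℕ :=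
  (chartN n s ++ useGatesRef (chartLen n s) (coordRef n s) (n * n) B, .gate (chartLen n s + useOut (n * n) B))

variable {n s}

/-- Gate references have no variables. [folklore] -/
private theorem rename_gateOp {M : ℕ} (j : ℕ) :
    (Operand.gate j : Operand ℤ (Fin M)).rename Fin.val = (Operand.gate j : Operand ℤ ℕ) := rfl

/-- Realised guessed gates have no variables. [folklore] -/
private theorem rename_toGate {M : ℕ} (base : ℕ) (g : KGate) :
    (g.toGate base : Gate ℤ (Fin M)).rename Fin.val = (g.toGate base : Gate ℤ ℕ) := by
  obtain ⟨kd, a, b⟩ := g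
  have hop : ∀ u : KOp, (u.toOperand base : Operand ℤ (Fin M)).rename Fin.val = (u.toOperand base : Operand ℤ ℕ) :=
    fun u => by cases u <;> rfl
  cases kd <;> simp [KGate.toGate, Gate.rename, hop]

/-- Renaming a use behind gate references (no variables). [folklore] -/
private theorem map_rename_useGatesRef {M : ℕ} (base : ℕ) (refs : ℕ → ℕ) (N : ℕ) (B : KBlock) :
    (useGatesRef base refs N B : List (Gate ℤ (Fin M))).map (Gate.rename Fin.val) = useGatesRef base refs N B := by
  simp only [useGatesRef, List.map_cons, List.map_append, List.map_map, Function.comp_def, rename_toGate]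
  rfl

/-- The linear factor forgets to its twin. [folklore] -/
private theorem rename_linGate (r : ℕ) : (linGate n s r).rename Fin.val = linGateN n s r := by
  simp only [linGate, linGateN, Gate.rename, List.map_cons, List.map_nil, rename_varOp]
  rfl

/-- The numerator gate forgets to its twin. [folklore] -/
private theorem rename_numGate (r : ℕ) : (numGate n s r).rename Fin.val = numGateN n s r := by
  simp [numGate, numGateN, Gate.rename, List.map_map, Function.comp_def, Operand.rename]

/-- The term gate forgets to its twin. [folklore] -/
private theorem rename_termGate (r : ℕ) : (termGate n s r).rename Fin.val = termGateN n s r := by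
  simp only [termGate, termGateN, Gate.rename, List.map_cons, List.map_nil, rename_varOp]
  rfl

/-- The label gate forgets to its twin. [folklore] -/
private theorem rename_svGate (a : ℕ) : (svGate n s a).rename Fin.val = svGateN n s a := by
  simp [svGate, svGateN, Gate.rename, List.map_map, Function.comp_def, Operand.rename]

/-- The valuation gate forgets to its twin. [folklore] -/
private theorem rename_valGate (r : ℕ) : (valGate n s r).rename Fin.val = valGateN n s r := by
  unfold valGate valGateN
  split_ifs <;> simp [Gate.rename, List.map_map, Function.comp_def, Operand.rename]

/-- The output gate forgets to its twin. [folklore] -/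
private theorem rename_outGate (r : ℕ) : (outGate n s r).rename Fin.val = outGateN n s r := by
  unfold outGate outGateN
  split_ifs <;> simp [Gate.rename, List.map_map, Function.comp_def, Operand.rename]

/-- The chart forgets to its twin. [folklore] -/
private theorem map_rename_chart : (chart n s).map (Gate.rename Fin.val) = chartN n s := by
  simp only [chart, chartN, linGates, numGates, termGates, svGates, valGates, outGates, List.map_append,
    List.map_map, Function.comp_def, rename_linGate, rename_numGate, rename_termGate, rename_svGate,
    rename_valGate, rename_outGate]

/-- **The circuit `C ∘ Ũ_n` forgets to its twin.** [cite: KumarVolk2022, §6 (proof of Cor. 1.3)] -/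
theorem forgetFin_univCircuit (n s : ℕ) (B : KBlock) : forgetFin (univCircuit n s B) = univBodyN n s B := by
  simp only [forgetFin, univCircuit, univBodyN, List.map_append, map_rename_chart, map_rename_useGatesRef,
    rename_gateOp]

/-- **The word of the twin is the `PITLanguage` instance of `C ∘ Ũ_n`.** [cite: KumarVolk2022, §6 (proof of Cor. 1.3)] -/
theorem wordE_univBodyN (n s : ℕ) (B : KBlock) :
    wordE (s + s, univBodyN n s B) = circuitWord (s + s) (univCircuit n s B) := by
  rw [circuitWord_eq_wordE, forgetFin_univCircuit]

end Twins

/-! ### §2. The blocks on codes -/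

section Writers

variable {T : Type} {eT : T → List Bool} {nf sf : T → ℕ}

/-- Unary product (via the tree's `unitsMul`). [cite: AroraBarak2009, §1.3] -/
private theorem unMulFP {f g : T → ℕ} (hf : CodeFP eT unE f) (hg : CodeFP eT unE g) :
    CodeFP eT unE (fun t => f t * g t) :=
  ((ulength unitE).comp (unitsMul.comp ((replicateUnit.comp hf).pair (replicateUnit.comp hg)))).congr
    fun p => by simp

/-- A unary numeral, read in binary. [folklore] -/
private theorem natOfUn' {f : T → ℕ} (h : CodeFP eT unE f) : CodeFP eT natE f := (natOfUn.comp h).congr fun _ => rfl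

/-- `S = nSlot n s` in unary. [cite: AroraBarak2009, §1.3] -/
private theorem nSlotUFP (hn : CodeFP eT unE nf) (hs : CodeFP eT unE sf) :
    CodeFP eT unE (fun t => nSlot (nf t) (sf t)) :=
  (unAdd.comp ((unMulFP hs hn).pair (unAdd.comp ((unMulFP hs hs).pair (unMulFP hn (unAdd.comp (hn.pair hs))))))).congr
    fun _ => rfl

/-- `S = nSlot n s` in binary. [cite: AroraBarak2009, §1.3] -/
private theorem nSlotFP (hn : CodeFP eT natE nf) (hs : CodeFP eT natE sf) :
    CodeFP eT natE (fun t => nSlot (nf t) (sf t)) :=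
  (natAdd.comp ((natMul.comp (hs.pair hn)).pair (natAdd.comp ((natMul.comp (hs.pair hs)).pair
    (natMul.comp (hn.pair (natAdd.comp (hn.pair hs)))))))).congr fun _ => rfl

/-- `svBase n s` in binary. [cite: AroraBarak2009, §1.3] -/
private theorem svBaseFP (hn : CodeFP eT natE nf) (hs : CodeFP eT natE sf) :
    CodeFP eT natE (fun t => svBase (nf t) (sf t)) := by
  have hsS : CodeFP eT natE (fun t => sf t * nSlot (nf t) (sf t)) := natMul.comp (hs.pair (nSlotFP hn hs))
  exact (natAdd.comp ((natAdd.comp (hsS.pair hsS)).pair hsS)).congr fun _ => rfl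

/-- `valBase n s` in binary. [cite: AroraBarak2009, §1.3] -/
private theorem valBaseFP (hn : CodeFP eT natE nf) (hs : CodeFP eT natE sf) :
    CodeFP eT natE (fun t => valBase (nf t) (sf t)) :=
  (natAdd.comp ((svBaseFP hn hs).pair (nSlotFP hn hs))).congr fun _ => rfl

/-- `outBase n s` in binary. [cite: AroraBarak2009, §1.3] -/
private theorem outBaseFP (hn : CodeFP eT natE nf) (hs : CodeFP eT natE sf) :
    CodeFP eT natE (fun t => outBase (nf t) (sf t)) :=
  (natAdd.comp ((valBaseFP hn hs).pair (natMul.comp ((natMul.comp (hs.pair hn)).pair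
    (natAdd.comp (hs.pair (const _ 1))))))).congr fun _ => rfl

/-- `chartLen n s` in binary. [cite: AroraBarak2009, §1.3] -/
private theorem chartLenFP (hn : CodeFP eT natE nf) (hs : CodeFP eT natE sf) :
    CodeFP eT natE (fun t => chartLen (nf t) (sf t)) :=
  (natAdd.comp ((outBaseFP hn hs).pair (natMul.comp ((natMul.comp (hn.pair hn)).pair
    (natAdd.comp (hs.pair (const _ 1))))))).congr fun _ => rfl

/-- `svIdx n s a` in binary. [cite: AroraBarak2009, §1.3] -/
private theorem svIdxFP {af : T → ℕ} (hn : CodeFP eT natE nf) (hs : CodeFP eT natE sf) (ha : CodeFP eT natE af) :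
    CodeFP eT natE (fun t => svIdx (nf t) (sf t) (af t)) :=
  (natAdd.comp ((svBaseFP hn hs).pair ha)).congr fun _ => rfl

/-- `valIdx n s t i` in binary. [cite: AroraBarak2009, §1.3] -/
private theorem valIdxFP {tf jf : T → ℕ} (hn : CodeFP eT natE nf) (hs : CodeFP eT natE sf)
    (ht : CodeFP eT natE tf) (hi : CodeFP eT natE jf) :
    CodeFP eT natE (fun t => valIdx (nf t) (sf t) (tf t) (jf t)) :=
  (natAdd.comp ((natAdd.comp ((valBaseFP hn hs).pair (natMul.comp ((natAdd.comp ((natMul.comp (ht.pair hn)).pair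
    hi)).pair (natAdd.comp (hs.pair (const _ 1))))))).pair hs)).congr fun _ => rfl

/-- **Block A on codes.** [cite: KumarVolk2022, Lemma 3.1 (proof)] [cite: AroraBarak2009, §1.3] -/
theorem linBlockFP (hnU : CodeFP eT unE nf) (hsU : CodeFP eT unE sf) :
    CodeFP eT (rawE gateE) (fun t => (List.range (sf t * nSlot (nf t) (sf t))).map (linGateN (nf t) (sf t))) := by
  have hs := natOfUn' hsU
  have hSU := nSlotUFP hnU hsU
  have tS : CodeFP (pairE eT natE) natE (fun t => nSlot (nf t.1) (sf t.1)) := (natOfUn' hSU).comp (fst _ _)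
  have ts : CodeFP (pairE eT natE) natE (fun t => sf t.1) := hs.comp (fst _ _)
  have tj : CodeFP (pairE eT natE) natE (fun t => t.2 / nSlot (nf t.1) (sf t.1)) := natDiv.comp ((snd _ _).pair tS)
  have ta : CodeFP (pairE eT natE) natE (fun t => t.2 % nSlot (nf t.1) (sf t.1)) := natMod.comp ((snd _ _).pair tS)
  have top1 : CodeFP (pairE eT natE) opE (fun t => varOpN (sf t.1 + sf t.1) (sf t.1 + t.2 / nSlot (nf t.1) (sf t.1))) :=
    varOpNFP.comp ((natAdd.comp (ts.pair ts)).pair (natAdd.comp (ts.pair tj)))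
  have top2 : CodeFP (pairE eT natE) opE (fun t => Operand.const ((t.2 % nSlot (nf t.1) (sf t.1) : ℕ) : ℤ)) :=
    (opConstFP.comp (smOfInt.comp (intOfNat.comp ta))).congr fun _ => rfl
  have targs : CodeFP (pairE eT natE) (rawE (pairE smE opE)) (fun t =>
      [((1 : ℤ), varOpN (sf t.1 + sf t.1) (sf t.1 + t.2 / nSlot (nf t.1) (sf t.1))),
        ((-1 : ℤ), Operand.const ((t.2 % nSlot (nf t.1) (sf t.1) : ℕ) : ℤ))]) :=
    ((rawCons _).comp (((const _ (1 : ℤ)).pair top1).pair ((rawCons _).comp (((const _ (-1 : ℤ)).pair top2).pair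
      (const _ ([] : List (ℤ × Operand ℤ ℕ))))))).congr fun _ => rfl
  have tgate : CodeFP (pairE eT natE) gateE (fun t => linGateN (nf t.1) (sf t.1) t.2) :=
    (gateSumFP.comp targs).congr fun _ => rfl
  exact ((CodeFP.map tgate).comp ((CodeFP.id eT).pair (urange.comp (unMulFP hsU hSU)))).congr fun _ => rfl

/-- **Block B on codes** (a filtered range inside each product gate). [cite: KumarVolk2022, Lemma 3.1 (proof)] [cite: AroraBarak2009, §1.3] -/
theorem numBlockFP (hnU : CodeFP eT unE nf) (hsU : CodeFP eT unE sf) :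
    CodeFP eT (rawE gateE) (fun t => (List.range (sf t * nSlot (nf t) (sf t))).map (numGateN (nf t) (sf t))) := by
  have hSU := nSlotUFP hnU hsU
  have tS : CodeFP (pairE eT natE) natE (fun t => nSlot (nf t.1) (sf t.1)) := (natOfUn' hSU).comp (fst _ _)
  have tSU : CodeFP (pairE eT natE) unE (fun t => nSlot (nf t.1) (sf t.1)) := hSU.comp (fst _ _)
  have tj : CodeFP (pairE eT natE) natE (fun t => t.2 / nSlot (nf t.1) (sf t.1)) := natDiv.comp ((snd _ _).pair tS)
  have ta : CodeFP (pairE eT natE) natE (fun t => t.2 % nSlot (nf t.1) (sf t.1)) := natMod.comp ((snd _ _).pair tS)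
  -- context `q = ((c, r), a')`
  have qp : CodeFP (pairE (pairE eT natE) natE) bitE (fun q => decide (q.2 ≠ q.1.2 % nSlot (nf q.1.1) (sf q.1.1))) :=
    (natEq.comp ((snd _ _).pair (ta.comp (fst _ _)))).not.congr fun q => by simp only [ne_eq, decide_not]
  have hfil : CodeFP (pairE eT natE) (rawE natE) (fun t =>
      (List.range (nSlot (nf t.1) (sf t.1))).filter fun a' => a' ≠ t.2 % nSlot (nf t.1) (sf t.1)) :=
    ((filter qp).comp ((CodeFP.id _).pair (urange.comp tSU))).congr fun _ => rfl
  have qop : CodeFP (pairE (pairE eT natE) natE) opE (fun q =>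
      Operand.gate (linIdx (nf q.1.1) (sf q.1.1) (q.1.2 / nSlot (nf q.1.1) (sf q.1.1)) q.2)) :=
    (opGateFP.comp (natAdd.comp ((natMul.comp ((tj.comp (fst _ _)).pair (tS.comp (fst _ _)))).pair (snd _ _)))).congr
      fun _ => rfl
  have targs : CodeFP (pairE eT natE) (rawE opE) (fun t =>
      ((List.range (nSlot (nf t.1) (sf t.1))).filter fun a' => a' ≠ t.2 % nSlot (nf t.1) (sf t.1)).map
        fun a' => Operand.gate (linIdx (nf t.1) (sf t.1) (t.2 / nSlot (nf t.1) (sf t.1)) a')) :=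
    (CodeFP.map qop).comp ((CodeFP.id _).pair hfil)
  have tgate : CodeFP (pairE eT natE) gateE (fun t => numGateN (nf t.1) (sf t.1) t.2) :=
    (gateProdFP.comp targs).congr fun _ => rfl
  exact ((CodeFP.map tgate).comp ((CodeFP.id eT).pair (urange.comp (unMulFP hsU hSU)))).congr fun _ => rfl

/-- **Block C1 on codes.** [cite: KumarVolk2022, Lemma 3.1 (proof)] [cite: AroraBarak2009, §1.3] -/
theorem termBlockFP (hnU : CodeFP eT unE nf) (hsU : CodeFP eT unE sf) :
    CodeFP eT (rawE gateE) (fun t => (List.range (sf t * nSlot (nf t) (sf t))).map (termGateN (nf t) (sf t))) := by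
  have hs := natOfUn' hsU
  have hSU := nSlotUFP hnU hsU
  have tS : CodeFP (pairE eT natE) natE (fun t => nSlot (nf t.1) (sf t.1)) := (natOfUn' hSU).comp (fst _ _)
  have ts : CodeFP (pairE eT natE) natE (fun t => sf t.1) := hs.comp (fst _ _)
  have tj : CodeFP (pairE eT natE) natE (fun t => t.2 / nSlot (nf t.1) (sf t.1)) := natDiv.comp ((snd _ _).pair tS)
  have ta : CodeFP (pairE eT natE) natE (fun t => t.2 % nSlot (nf t.1) (sf t.1)) := natMod.comp ((snd _ _).pair tS)
  have tnum : CodeFP (pairE eT natE) natE (fun t =>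
      numIdx (nf t.1) (sf t.1) (t.2 / nSlot (nf t.1) (sf t.1)) (t.2 % nSlot (nf t.1) (sf t.1))) :=
    (natAdd.comp ((natMul.comp (ts.pair tS)).pair (natAdd.comp ((natMul.comp (tj.pair tS)).pair ta)))).congr fun _ => rfl
  have tgate : CodeFP (pairE eT natE) gateE (fun t => termGateN (nf t.1) (sf t.1) t.2) :=
    (gateProd₂FP.comp ((opGateFP.comp tnum).pair (varOpNFP.comp ((natAdd.comp (ts.pair ts)).pair tj)))).congr
      fun _ => rfl
  exact ((CodeFP.map tgate).comp ((CodeFP.id eT).pair (urange.comp (unMulFP hsU hSU)))).congr fun _ => rfl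

/-- **Block C2 on codes** (a range of `s` terms inside each sum gate). [cite: KumarVolk2022, Lemma 3.1 (proof)] [cite: AroraBarak2009, §1.3] -/
theorem svBlockFP (hnU : CodeFP eT unE nf) (hsU : CodeFP eT unE sf) :
    CodeFP eT (rawE gateE) (fun t => (List.range (nSlot (nf t) (sf t))).map (svGateN (nf t) (sf t))) := by
  have hn := natOfUn' hnU
  have hs := natOfUn' hsU
  have hSU := nSlotUFP hnU hsU
  -- context `q = ((c, a), j)`
  have qn : CodeFP (pairE (pairE eT natE) natE) natE (fun q => nf q.1.1) := hn.comp (fst _ _).fst'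
  have qs : CodeFP (pairE (pairE eT natE) natE) natE (fun q => sf q.1.1) := hs.comp (fst _ _).fst'
  have qS : CodeFP (pairE (pairE eT natE) natE) natE (fun q => nSlot (nf q.1.1) (sf q.1.1)) := nSlotFP qn qs
  have qidx : CodeFP (pairE (pairE eT natE) natE) natE (fun q => termIdx (nf q.1.1) (sf q.1.1) q.2 q.1.2) :=
    (natAdd.comp ((natAdd.comp ((natMul.comp (qs.pair qS)).pair (natMul.comp (qs.pair qS)))).pair
      (natAdd.comp ((natMul.comp ((snd _ _).pair qS)).pair (fst _ _).snd')))).congr fun _ => rfl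
  have qitem : CodeFP (pairE (pairE eT natE) natE) (pairE smE opE) (fun q =>
      ((1 : ℤ), Operand.gate (termIdx (nf q.1.1) (sf q.1.1) q.2 q.1.2))) := (const _ (1 : ℤ)).pair (opGateFP.comp qidx)
  have targs : CodeFP (pairE eT natE) (rawE (pairE smE opE)) (fun t =>
      (List.range (sf t.1)).map fun j => ((1 : ℤ), Operand.gate (termIdx (nf t.1) (sf t.1) j t.2))) :=
    (CodeFP.map qitem).comp ((CodeFP.id _).pair (urange.comp (hsU.comp (fst _ _))))
  have tgate : CodeFP (pairE eT natE) gateE (fun t => svGateN (nf t.1) (sf t.1) t.2) :=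
    (gateSumFP.comp targs).congr fun _ => rfl
  exact ((CodeFP.map tgate).comp ((CodeFP.id eT).pair (urange.comp hSU))).congr fun _ => rfl

/-- **Block D on codes.** [cite: KumarVolk2022, §4.1] [cite: AroraBarak2009, §1.3] -/
theorem valBlockFP (hnU : CodeFP eT unE nf) (hsU : CodeFP eT unE sf) :
    CodeFP eT (rawE gateE) (fun t => (List.range (sf t * nf t * (sf t + 1))).map (valGateN (nf t) (sf t))) := by
  have hn := natOfUn' hnU
  have hs := natOfUn' hsU
  have tn : CodeFP (pairE eT natE) natE (fun t => nf t.1) := hn.comp (fst _ _)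
  have ts : CodeFP (pairE eT natE) natE (fun t => sf t.1) := hs.comp (fst _ _)
  have ts1 : CodeFP (pairE eT natE) natE (fun t => sf t.1 + 1) := natAdd.comp (ts.pair (const _ 1))
  have tu : CodeFP (pairE eT natE) natE (fun t => t.2 % (sf t.1 + 1)) := natMod.comp ((snd _ _).pair ts1)
  have tb : CodeFP (pairE eT natE) natE (fun t => t.2 / (sf t.1 + 1)) := natDiv.comp ((snd _ _).pair ts1)
  have tt : CodeFP (pairE eT natE) natE (fun t => t.2 / (sf t.1 + 1) / nf t.1) := natDiv.comp (tb.pair tn)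
  have ti : CodeFP (pairE eT natE) natE (fun t => t.2 / (sf t.1 + 1) % nf t.1) := natMod.comp (tb.pair tn)
  have c1 : CodeFP (pairE eT natE) bitE (fun t => decide (t.2 % (sf t.1 + 1) < sf t.1)) := natLt.comp (tu.pair ts)
  have c2 : CodeFP (pairE eT natE) bitE (fun t => decide (t.2 % (sf t.1 + 1) < t.2 / (sf t.1 + 1) / nf t.1)) :=
    natLt.comp (tu.pair tt)
  have hgg : CodeFP (pairE eT natE) natE (fun t => ggCode (nf t.1) (sf t.1) (t.2 / (sf t.1 + 1) / nf t.1) (t.2 % (sf t.1 + 1))) :=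
    (natAdd.comp ((natMul.comp (ts.pair tn)).pair (natAdd.comp ((natMul.comp (tt.pair ts)).pair tu)))).congr fun _ => rfl
  have hprod : CodeFP (pairE eT natE) gateE (fun t => Gate.prod
      [Operand.gate (svIdx (nf t.1) (sf t.1) (ggCode (nf t.1) (sf t.1) (t.2 / (sf t.1 + 1) / nf t.1) (t.2 % (sf t.1 + 1)))),
        Operand.gate (valIdx (nf t.1) (sf t.1) (t.2 % (sf t.1 + 1)) (t.2 / (sf t.1 + 1) % nf t.1))]) :=
    gateProd₂FP.comp ((opGateFP.comp (svIdxFP tn ts hgg)).pair (opGateFP.comp (valIdxFP tn ts tu ti)))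
  have hin : CodeFP (pairE eT natE) natE (fun t => inCode (nf t.1) (t.2 / (sf t.1 + 1) / nf t.1) (t.2 / (sf t.1 + 1) % nf t.1)) :=
    (natAdd.comp ((natMul.comp (tt.pair tn)).pair ti)).congr fun _ => rfl
  -- context `q = ((c, r), t')`
  have qbase : CodeFP (pairE (pairE eT natE) natE) natE (fun q =>
      valBase (nf q.1.1) (sf q.1.1) + q.1.2 / (sf q.1.1 + 1) * (sf q.1.1 + 1) + q.2) :=
    natAdd.comp ((natAdd.comp (((valBaseFP tn ts).comp (fst _ _)).pair (natMul.comp ((tb.comp (fst _ _)).pair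
      (ts1.comp (fst _ _)))))).pair (snd _ _))
  have qitem : CodeFP (pairE (pairE eT natE) natE) (pairE smE opE) (fun q =>
      ((1 : ℤ), Operand.gate (valBase (nf q.1.1) (sf q.1.1) + q.1.2 / (sf q.1.1 + 1) * (sf q.1.1 + 1) + q.2))) :=
    (const _ (1 : ℤ)).pair (opGateFP.comp qbase)
  have hsumArgs : CodeFP (pairE eT natE) (rawE (pairE smE opE)) (fun t =>
      ((1 : ℤ), Operand.gate (svIdx (nf t.1) (sf t.1) (inCode (nf t.1) (t.2 / (sf t.1 + 1) / nf t.1) (t.2 / (sf t.1 + 1) % nf t.1)))) ::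
        (List.range (sf t.1)).map fun t' => ((1 : ℤ), Operand.gate (valBase (nf t.1) (sf t.1) + t.2 / (sf t.1 + 1) * (sf t.1 + 1) + t'))) :=
    (rawCons _).comp ((((const _ (1 : ℤ)).pair (opGateFP.comp (svIdxFP tn ts hin)))).pair
      ((CodeFP.map qitem).comp ((CodeFP.id _).pair (urange.comp (hsU.comp (fst _ _))))))
  have hsum : CodeFP (pairE eT natE) gateE (fun t => Gate.sum
      (((1 : ℤ), Operand.gate (svIdx (nf t.1) (sf t.1) (inCode (nf t.1) (t.2 / (sf t.1 + 1) / nf t.1) (t.2 / (sf t.1 + 1) % nf t.1)))) ::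
        (List.range (sf t.1)).map fun t' => ((1 : ℤ), Operand.gate (valBase (nf t.1) (sf t.1) + t.2 / (sf t.1 + 1) * (sf t.1 + 1) + t')))) :=
    gateSumFP.comp hsumArgs
  have tgate : CodeFP (pairE eT natE) gateE (fun t => valGateN (nf t.1) (sf t.1) t.2) :=
    (c1.ite (c2.ite hprod (const _ (Gate.sum ([] : List (ℤ × Operand ℤ ℕ))))) hsum).congr fun t => by
      simp only [valGateN, decide_eq_true_eq]
  have hlenU : CodeFP eT unE (fun t => sf t * nf t * (sf t + 1)) :=
    unMulFP (unMulFP hsU hnU) (unSucc.comp hsU)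
  exact ((CodeFP.map tgate).comp ((CodeFP.id eT).pair (urange.comp hlenU))).congr fun _ => rfl

/-- **Block E on codes.** [cite: KumarVolk2022, §4.1] [cite: AroraBarak2009, §1.3] -/
theorem outBlockFP (hnU : CodeFP eT unE nf) (hsU : CodeFP eT unE sf) :
    CodeFP eT (rawE gateE) (fun t => (List.range (nf t * nf t * (sf t + 1))).map (outGateN (nf t) (sf t))) := by
  have hn := natOfUn' hnU
  have hs := natOfUn' hsU
  have tn : CodeFP (pairE eT natE) natE (fun t => nf t.1) := hn.comp (fst _ _)
  have ts : CodeFP (pairE eT natE) natE (fun t => sf t.1) := hs.comp (fst _ _)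
  have ts1 : CodeFP (pairE eT natE) natE (fun t => sf t.1 + 1) := natAdd.comp (ts.pair (const _ 1))
  have tu : CodeFP (pairE eT natE) natE (fun t => t.2 % (sf t.1 + 1)) := natMod.comp ((snd _ _).pair ts1)
  have tb : CodeFP (pairE eT natE) natE (fun t => t.2 / (sf t.1 + 1)) := natDiv.comp ((snd _ _).pair ts1)
  have tt : CodeFP (pairE eT natE) natE (fun t => t.2 / (sf t.1 + 1) / nf t.1) := natDiv.comp (tb.pair tn)
  have ti : CodeFP (pairE eT natE) natE (fun t => t.2 / (sf t.1 + 1) % nf t.1) := natMod.comp (tb.pair tn)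
  have c1 : CodeFP (pairE eT natE) bitE (fun t => decide (t.2 % (sf t.1 + 1) < sf t.1)) := natLt.comp (tu.pair ts)
  have hoo : CodeFP (pairE eT natE) natE (fun t => sf t.1 * nf t.1 + sf t.1 * sf t.1 +
      (t.2 / (sf t.1 + 1) / nf t.1 * (nf t.1 + sf t.1))) :=
    natAdd.comp ((natAdd.comp ((natMul.comp (ts.pair tn)).pair (natMul.comp (ts.pair ts)))).pair
      (natMul.comp (tt.pair (natAdd.comp (tn.pair ts)))))
  have hog : CodeFP (pairE eT natE) natE (fun t => ogCode (nf t.1) (sf t.1) (t.2 / (sf t.1 + 1) / nf t.1) (t.2 % (sf t.1 + 1))) :=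
    (natAdd.comp (hoo.pair (natAdd.comp (tn.pair tu)))).congr fun t => by simp only [ogCode]; ring
  have hoi : CodeFP (pairE eT natE) natE (fun t => oiCode (nf t.1) (sf t.1) (t.2 / (sf t.1 + 1) / nf t.1) (t.2 / (sf t.1 + 1) % nf t.1)) :=
    (natAdd.comp (hoo.pair ti)).congr fun t => by simp only [oiCode]; ring
  have hprod : CodeFP (pairE eT natE) gateE (fun t => Gate.prod
      [Operand.gate (svIdx (nf t.1) (sf t.1) (ogCode (nf t.1) (sf t.1) (t.2 / (sf t.1 + 1) / nf t.1) (t.2 % (sf t.1 + 1)))),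
        Operand.gate (valIdx (nf t.1) (sf t.1) (t.2 % (sf t.1 + 1)) (t.2 / (sf t.1 + 1) % nf t.1))]) :=
    gateProd₂FP.comp ((opGateFP.comp (svIdxFP tn ts hog)).pair (opGateFP.comp (valIdxFP tn ts tu ti)))
  have qbase : CodeFP (pairE (pairE eT natE) natE) natE (fun q =>
      outBase (nf q.1.1) (sf q.1.1) + q.1.2 / (sf q.1.1 + 1) * (sf q.1.1 + 1) + q.2) :=
    natAdd.comp ((natAdd.comp (((outBaseFP tn ts).comp (fst _ _)).pair (natMul.comp ((tb.comp (fst _ _)).pair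
      (ts1.comp (fst _ _)))))).pair (snd _ _))
  have qitem : CodeFP (pairE (pairE eT natE) natE) (pairE smE opE) (fun q =>
      ((1 : ℤ), Operand.gate (outBase (nf q.1.1) (sf q.1.1) + q.1.2 / (sf q.1.1 + 1) * (sf q.1.1 + 1) + q.2))) :=
    (const _ (1 : ℤ)).pair (opGateFP.comp qbase)
  have hsum : CodeFP (pairE eT natE) gateE (fun t => Gate.sum
      (((1 : ℤ), Operand.gate (svIdx (nf t.1) (sf t.1) (oiCode (nf t.1) (sf t.1) (t.2 / (sf t.1 + 1) / nf t.1) (t.2 / (sf t.1 + 1) % nf t.1)))) ::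
        (List.range (sf t.1)).map fun t' => ((1 : ℤ), Operand.gate (outBase (nf t.1) (sf t.1) + t.2 / (sf t.1 + 1) * (sf t.1 + 1) + t')))) :=
    gateSumFP.comp ((rawCons _).comp ((((const _ (1 : ℤ)).pair (opGateFP.comp (svIdxFP tn ts hoi)))).pair
      ((CodeFP.map qitem).comp ((CodeFP.id _).pair (urange.comp (hsU.comp (fst _ _)))))))
  have tgate : CodeFP (pairE eT natE) gateE (fun t => outGateN (nf t.1) (sf t.1) t.2) :=
    (c1.ite hprod hsum).congr fun t => by simp only [outGateN, decide_eq_true_eq]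
  have hlenU : CodeFP eT unE (fun t => nf t * nf t * (sf t + 1)) := unMulFP (unMulFP hnU hnU) (unSucc.comp hsU)
  exact ((CodeFP.map tgate).comp ((CodeFP.id eT).pair (urange.comp hlenU))).congr fun _ => rfl

/-- **The chart on codes.** [cite: KumarVolk2022, §4.1] [cite: AroraBarak2009, §1.3] -/
theorem chartNFP (hnU : CodeFP eT unE nf) (hsU : CodeFP eT unE sf) :
    CodeFP eT (rawE gateE) (fun t => chartN (nf t) (sf t)) :=
  ((rawAppend gateE).comp (((rawAppend gateE).comp (((rawAppend gateE).comp (((rawAppend gateE).comp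
    (((rawAppend gateE).comp ((linBlockFP hnU hsU).pair (numBlockFP hnU hsU))).pair (termBlockFP hnU hsU))).pair
    (svBlockFP hnU hsU))).pair (valBlockFP hnU hsU))).pair (outBlockFP hnU hsU))).congr fun _ => rfl

/-- **The body of `C ∘ Ũ_n` on codes**: the chart, one use of the guessed gate list read off the
witness string, and the output reference. [cite: KumarVolk2022, §6 (proof of Cor. 1.3)] [cite: AroraBarak2009, §1.3] -/
theorem univBodyNFP {wit : T → List Bool} (hnU : CodeFP eT unE nf) (hsU : CodeFP eT unE sf)
    (hw : CodeFP eT strE wit) :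
    CodeFP eT circE (fun t => univBodyN (nf t) (sf t) (readBlock (wit t))) := by
  have hn := natOfUn' hnU
  have hs := natOfUn' hsU
  have hL : CodeFP eT natE (fun t => chartLen (nf t) (sf t)) := chartLenFP hn hs
  have hrefs : CodeFP (pairE eT natE) natE (fun q => coordRef (nf q.1) (sf q.1) q.2) := by
    have qn : CodeFP (pairE eT natE) natE (fun q => nf q.1) := hn.comp (fst _ _)
    have qs : CodeFP (pairE eT natE) natE (fun q => sf q.1) := hs.comp (fst _ _)
    have qj : CodeFP (pairE eT natE) natE (fun q => q.2 / nf q.1) := natDiv.comp ((snd _ _).pair qn)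
    have qi : CodeFP (pairE eT natE) natE (fun q => q.2 % nf q.1) := natMod.comp ((snd _ _).pair qn)
    have qblk : CodeFP (pairE eT natE) natE (fun q => (q.2 / nf q.1 * nf q.1 + q.2 % nf q.1) * (sf q.1 + 1)) :=
      natMul.comp ((natAdd.comp ((natMul.comp (qj.pair qn)).pair qi)).pair (natAdd.comp (qs.pair (const _ 1))))
    exact (natAdd.comp ((natAdd.comp (((outBaseFP hn hs).comp (fst _ _)).pair qblk)).pair qs)).congr fun _ => rfl
  have huse : CodeFP eT (rawE gateE) (fun t => (useGatesRef (chartLen (nf t) (sf t)) (coordRef (nf t) (sf t))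
      (nf t * nf t) (readBlock (wit t)) : List (Gate ℤ ℕ))) :=
    (useGatesRefFP hL hrefs (urange.comp (unMulFP hnU hnU)) hw).congr fun _ => rfl
  have hgates : CodeFP eT (listE gateE) (fun t => chartN (nf t) (sf t) ++ useGatesRef (chartLen (nf t) (sf t))
      (coordRef (nf t) (sf t)) (nf t * nf t) (readBlock (wit t))) :=
    (listOfRaw gateE).comp ((rawAppend gateE).comp ((chartNFP hnU hsU).pair huse))
  have hout : CodeFP eT opE (fun t => Operand.gate (chartLen (nf t) (sf t) + useOut (nf t * nf t) (readBlock (wit t)))) :=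
    (opGateFP.comp (natAdd.comp (hL.pair (natAdd.comp ((natMul.comp (hn.pair hn)).pair (blockLengthFP hw)))))).congr
      fun _ => rfl
  exact (hgates.pair hout).congr fun _ => rfl

/-! ### §3. The code word of `C ∘ Ũ_n` -/

/-- **The `PITLanguage` instance `C ∘ Ũ_n` is written in polynomial time**: on any context carrying
`1^n`, `1^s` and a witness string as `CodeFP` data, `c ↦ wordE (s+s, univBodyN n s (readBlock (wit c)))`
is computed on codes by a polynomial-time string function (KV §6: the verifier "uses polynomial
identity testing to check" `C ∘ U ≡ 0`, which presupposes writing the instance). [cite: KumarVolk2022, §6 (proof of Cor. 1.3)] [cite: AroraBarak2009, §1.3] -/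
theorem univWordFP {wit : T → List Bool} (hnU : CodeFP eT unE nf) (hsU : CodeFP eT unE sf)
    (hw : CodeFP eT strE wit) :
    CodeFP eT wordE (fun t => (sf t + sf t, univBodyN (nf t) (sf t) (readBlock (wit t)))) :=
  (natAdd.comp ((natOfUn' hsU).pair (natOfUn' hsU))).pair (univBodyNFP hnU hsU hw)

/-- **The written word is the code word of `univCircuit`.** [cite: KumarVolk2022, §6 (proof of Cor. 1.3)] -/
theorem univWord_eq {wit : T → List Bool} (t : T) :
    wordE (sf t + sf t, univBodyN (nf t) (sf t) (readBlock (wit t))) =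
      circuitWord (sf t + sf t) (univCircuit (nf t) (sf t) (readBlock (wit t))) :=
  wordE_univBodyN _ _ _

/-- **String form**: a polynomial-time string function writing, from the code of a context, the
`PITLanguage` instance of `C ∘ Ũ_n` for the guessed gate list read off the witness.
[cite: KumarVolk2022, §6 (proof of Cor. 1.3)] -/
theorem exists_univWordFn {wit : T → List Bool} (hnU : CodeFP eT unE nf) (hsU : CodeFP eT unE sf)
    (hw : CodeFP eT strE wit) :
    ∃ f ∈ FP, ∀ t : T, f (eT t) = circuitWord (sf t + sf t) (univCircuit (nf t) (sf t) (readBlock (wit t))) := by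
  obtain ⟨f, hf, hft⟩ := univWordFP hnU hsU hw
  exact ⟨f, hf, fun t => by rw [hft, wordE_univBodyN]⟩

end Writers

/-! ### §4. Bridge to the integer universal map `universalMapInt` (brick (Uℤ)) -/

section Bridge

open MvPolynomial

variable (n s : ℕ)

/-- The explicit slot numbering of the chart is the slot index of `KV20UniversalMapInt.lean`.
[cite: KumarVolk2022, §4.1] -/
theorem slotCode_eq_slotEquiv (e : USlot n s) : slotCode n s e = (slotEquiv n s e : ℕ) := by
  rcases e with ⟨t, i⟩ | ⟨t, t'⟩ | ⟨j, i | t⟩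
  · rw [val_slotEquiv_in]; simp only [slotCode, inCode]; ring
  · rw [val_slotEquiv_gate]; simp only [slotCode, ggCode]; ring
  · rw [val_slotEquiv_outIn]; simp only [slotCode, oiCode]; ring
  · rw [val_slotEquiv_outGate]; simp only [slotCode, ogCode]; ring

/-- The chart's numerator is the Lagrange numerator of `KV20UniversalMapInt.lean` at the node of a
slot, in the chart's variables (`y_j = var (s + j)`). [cite: KumarVolk2022, Lemma 3.1 (proof)] -/
theorem numVal_eq_rename_lagrangeNumerator (e : USlot n s) (j : Fin s) :
    numVal n s j (slotCode n s e) =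
      MvPolynomial.rename finSumFinEquiv (lagrangeNumerator (slotNode n s) e (Sum.inr j : Fin s ⊕ Fin s)) := by
  rw [lagrangeNumerator, map_prod, numVal]
  have hy : varP (s + s) (s + j) = X (Fin.natAdd s j) := by
    rw [varP, dif_pos (by omega)]
    congr 1
  simp only [map_sub, rename_X, rename_C, slotNode_apply, finSumFinEquiv_apply_right, linVal, hy]
  -- reindex the product along `e' ↦ slotEquiv e'`
  refine (Finset.prod_nbij (fun e' => (slotEquiv n s e' : ℕ)) ?_ ?_ ?_ fun e' _ => rfl).symm
  · intro e' he'
    rw [Finset.mem_erase] at he' ⊢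
    refine ⟨fun h => he'.1 ?_, Finset.mem_range.2 (slotEquiv n s e').isLt⟩
    rw [slotCode_eq_slotEquiv] at h
    exact (slotEquiv n s).injective (Fin.ext h)
  · intro e₁ _ e₂ _ h
    exact (slotEquiv n s).injective (Fin.ext h)
  · intro a ha
    rw [Finset.mem_coe, Finset.mem_erase, Finset.mem_range] at ha
    refine ⟨(slotEquiv n s).symm ⟨a, ha.2⟩, ?_, by simp⟩
    rw [Finset.mem_coe, Finset.mem_erase]
    refine ⟨fun h => ha.1 ?_, Finset.mem_univ _⟩
    rw [← h, slotCode_eq_slotEquiv, Equiv.apply_symm_apply]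

/-- **The chart's labels are the integer Shpilka–Volkovich labels of `KV20UniversalMapInt.lean`**, in
the chart's variables. [cite: KumarVolk2022, §4.1 ("The edge e_i is labeled by the i-th coordinate of SV")] -/
theorem svLabel_eq_rename_svMapInt (e : USlot n s) :
    svLabel n s e = MvPolynomial.rename finSumFinEquiv (svMapInt (slotNode n s) s e) := by
  rw [svLabel, svMapInt, map_sum, svVal, ← Fin.sum_univ_eq_sum_range]
  refine Finset.sum_congr rfl fun j _ => ?_
  rw [map_mul, rename_X, finSumFinEquiv_apply_left, termVal, numVal_eq_rename_lagrangeNumerator]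
  congr 1
  rw [varP, dif_pos (by omega)]
  congr 1

/-- **The chart computes the integer universal map** `Ũ` (entry `(j, i)`), in its variables.
[cite: KumarVolk2022, §4.1] -/
theorem ucOut_svLabel_eq (j i : Fin n) :
    ucOut (svLabel n s) j i = MvPolynomial.rename finSumFinEquiv (universalMapInt n s (j, i)) := by
  have h := map_ucOut (MvPolynomial.rename (R := ℤ) (finSumFinEquiv : Fin s ⊕ Fin s ≃ Fin (s + s))).toRingHom
    (fun e => svMapInt (slotNode n s) s e) j i
  rw [universalMapInt]
  change _ = (MvPolynomial.rename (R := ℤ) (finSumFinEquiv : Fin s ⊕ Fin s ≃ Fin (s + s))).toRingHom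
    (ucOut (fun e => svMapInt (slotNode n s) s e) j i)
  rw [h]
  congr 1
  funext e
  exact svLabel_eq_rename_svMapInt n s e

/-- The polynomial of a guessed gate list over `n²` inputs, as a polynomial in the matrix entries
`(j, i) = (q / n, q % n)`. [cite: KumarVolk2022, §6 (proof of Cor. 1.3)] -/
def blockPolyMat (n : ℕ) (B : KBlock) : MvPolynomial (Fin n × Fin n) ℤ :=
  rename (fun q : Fin (n * n) => (finDiv q, finMod q)) (blockPoly (n * n) B)

/-- **`univCircuit` computes `C ∘ Ũ_n`** for the guessed gate list `C = B`, read as a polynomial in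
the matrix entries, in the chart's variables. [cite: KumarVolk2022, §6 (proof of Cor. 1.3)] -/
theorem eval_univCircuit_eq_rename_bind₁ (B : KBlock) :
    (univCircuit n s B).eval =
      MvPolynomial.rename finSumFinEquiv (bind₁ (universalMapInt n s) (blockPolyMat n B)) := by
  rw [eval_univCircuit, blockPolyMat, bind₁_rename, rename_bind₁, ← aeval_eq_bind₁]
  refine congrArg (fun f => aeval f (blockPoly (n * n) B)) (funext fun q => ?_)
  rw [Function.comp_apply, ucOut_svLabel_eq]

/-- **The identity test of the verifier**: `univCircuit n s B` computes the zero polynomial iff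
`C ∘ Ũ_n ≡ 0` as an integer polynomial identity, `bind₁ (universalMapInt n s) (blockPolyMat n B) = 0`
(the hypothesis of `KumarVolk2020.not_mem_smallLinCircuitSet_of_eval_ne_zero`).
[cite: KumarVolk2022, §6 (proof of Cor. 1.3: "C ∘ U ≡ 0")] -/
theorem eval_univCircuit_eq_zero_iff (B : KBlock) :
    (univCircuit n s B).eval = 0 ↔ bind₁ (universalMapInt n s) (blockPolyMat n B) = 0 := by
  rw [eval_univCircuit_eq_rename_bind₁]
  constructor
  · intro h
    exact rename_injective _ (finSumFinEquiv.injective) (by rwa [map_zero])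
  · intro h
    rw [h, map_zero]

end Bridge

end UnivCircuit

end KumarVolk2020

end Literature.Computability.AlgebraicComplexity
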